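import Summits.ResolutionOfSingularities.ResolutionOfSingularities.Theorems.PurelyInseparableDim4ResConeStretchLedger
import Summits.ResolutionOfSingularities.ResolutionOfSingularities.Theorems.PurelyInseparableDim4ResConeLinearReframe
import Summits.ResolutionOfSingularities.ResolutionOfSingularities.Theorems.PurelyInseparableDim4IsolatedPowerIdeal
import HarnessLib
import HarnessLib.Audit.Tags

/-!
# Purely inseparable four-folds — SLICE B along a chain, (K11-lin): the one-letter ledger of a stretch-born KEPT
# letter is generated by the CURRENT VERTEX FORM — `u·G_k ∈ (x_a, ℓ_k^d)` EXACTLY — and two such letters merge to the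
# EXACT pair ledger `U·G_k = S·x_a x_{a′} + T·ℓ_k^d` (cell `res-dim4-pi`, K2(p) lane, slice B; C∞ assembly K24c L2b)

[OURS · counted 0 · cell `res-dim4-pi` · K2(p) lane holder res-dim4-p-12 g3; C∞ assembly owner res-dim4-p-3 g4
(proposal «K11-lin», bus 2026-08-29 03:37Z; K-side check res-dim4-crit-4 g4 03:38Z).]  Nothing here proves K2(p)
(`RidgeBudget.NoAboveFloorTrap p p`), `NoIsolatedTrap p p` or resolution of singularities in dimension ≥ 4 /
characteristic `p` — NOT proved.  AI kernel work, weaker than expert review.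

WHAT IS NEW.  res-dim4-p-2 g3's K11 `stretch_ledger_core` (over res-dim4-p-3 g3's K3 seed
`divMonomial_step_mem_span_of_powerCone` and K4 `ledger_persist`) proves, for a letter `a = j_{k₁}` born in a
power-cone stretch and kept on `(k₁, k)`, a ledger `u·G_k ∈ (x_a, h^d)` with `u(0) ≠ 0` and SOME `h ∈ 𝔪₀`.  But the
generator is born LINEAR (`Σ_{i ≠ j} ℓ_i x_i` at the seed) and the one-step transport
`T₁ = chartTransform 1 univ j ∘ shear j b` maps a linear form satisfying the DIRECTION EQUATION `m_j + m·b = 0` to the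
linear form `Σ_{i ≠ j} m_i x_i` (no constant, no `x_j`; §1 `chartTransform_one_shear_linearForm`); by res-dim4-p-11
g3's K9 `exists_homogeneousComponent_one_eq_of_ledger` a linear generator is `κ·ℓ_k + κ′·x_a` with `κ ≠ 0`, and
`(x_a, (κℓ + κ′x_a)^d) = (x_a, ℓ^d)` (§1 `span_X_pow_eq_of_eq_linear`).  Hence:

* §2 **`stretch_ledger_linear`** (K11a-lin) — same binders as `stretch_ledger_core`:
  `∃ u, u(0) ≠ 0 ∧ u·G_k ∈ (x_a, (Σ_i ℓ_k i·x_i)^d)` — the ledger is generated by the CURRENT vertex form, EXACTLY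
  (no jet, no order `M`).
* §3 **`stretch_pair_ledger_linear`** (K11-lin, pair form) — two distinct stretch-born kept letters `a, a′` and a
  third letter `e` carrying `ℓ_k`: `∃ U S T, U(0) ≠ 0 ∧ U·G_k = S·(x_a x_{a′}) + T·(Σ_i ℓ_k i·x_i)^d` (merge by
  res-dim4-p-12 g3's K2 `mem_span_mul_of_mem_span_of_mem_span`; the COMMON generator `ℓ_k` is what makes the merge
  immediate — compare res-dim4-p-2 g4's `pair_hasse_ledger_of_born_at`, whose generator is a Hasse derivative).

CONSEQUENCE FOR THE C∞ ASSEMBLY (design (iii), K24c L2b): after the LINEAR straightening `x_f ↦ x_f − Σ_{i≠f}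
(ℓ_i/ℓ_f) x_i` the pair ledger is the MONOMIAL ideal `(x_λ x_μ, x_f^d)` and res-dim4-typ-1 g3's read-off
`coeff_eq_zero_of_pair_ledger_pow` applies with `R = 0` at EVERY order: the pair-ledger divisibility of the frame is
exact, F2a's ledger exception dies at every degree, and the C∞ window game is fed unguarded (next file).

[cite: CossartJannsenSaito2020, Thm. 3.10(4), Thm. 3.14]
bears_on: LADDER-RESOLUTION:D157-DOOR2 (res-dim4-pi · K2(p) slice B · (K11-lin)).
Supports stmt-ResolutionOfSingularities-16155 (helper).
-/

set_option linter.dupNamespace false -- mandated namespace of this single-conjunct summit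

noncomputable section

namespace Summit.ResolutionOfSingularities.ResolutionOfSingularities.Theorems.PIDim4

namespace ResCone

open MvPolynomial Finset
open Literature.AlgebraicGeometry.Resolution
open Literature.AlgebraicGeometry.Resolution.CentreBlowup
open Literature.AlgebraicGeometry.Resolution.Hauser2010
open Literature.AlgebraicGeometry.Resolution.HauserPerlega2019
open PointBlowup (polarMap additiveSubspace direction)

variable {K : Type} [Field K]

/-! ## §1 Linear forms under the one-step transport; change of generator -/

/-- A linear form vanishes at the origin: `Σ mᵢ xᵢ ∈ 𝔪₀`. [folklore] -/
theorem linearForm_mem_originIdeal (m : Fin 4 → K) :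
    (∑ i, C (m i) * X i : MvPolynomial (Fin 4) K) ∈ originIdeal K := by
  unfold originIdeal
  rw [RingHom.mem_ker, map_sum]
  exact Finset.sum_eq_zero fun i _ => by rw [map_mul, eval_X, Pi.zero_apply, mul_zero]

/-- **Hauser's shear of a linear form**: `shear_{j,b} (Σ mᵢ xᵢ) = Σ mᵢ xᵢ + (m·b)·x_j` (`b_j = 0`).
[cite: Hauser2010, §I (definition of P⁺)] -/
theorem shear_linearForm (j : Fin 4) {b : Fin 4 → K} (hbj : b j = 0) (m : Fin 4 → K) :
    shear j b (∑ i, C (m i) * X i : MvPolynomial (Fin 4) K) =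
      (∑ i, C (m i) * X i) + C (dotProduct m b) * X j := by
  unfold shear
  rw [map_sum]
  have hterm : ∀ i : Fin 4,
      aeval (fun i => if i = j then (X j : MvPolynomial (Fin 4) K) else X i + C (b i) * X j) (C (m i) * X i) =
        C (m i) * X i + C (m i * b i) * X j := by
    intro i
    rw [map_mul, aeval_C, aeval_X, MvPolynomial.algebraMap_eq]
    by_cases hij : i = j
    · subst hij
      rw [if_pos rfl, hbj, mul_zero, C_0, zero_mul, add_zero]
    · rw [if_neg hij, mul_add, map_mul, mul_assoc]
  rw [Finset.sum_congr rfl fun i _ => hterm i, Finset.sum_add_distrib, ← Finset.sum_mul, ← map_sum]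
  rfl

/-- Adding a multiple of `x_j` to a linear form updates its `j`-th coefficient. [folklore] -/
theorem linearForm_add_C_mul_X (m : Fin 4 → K) (j : Fin 4) (t : K) :
    (∑ i, C (m i) * X i : MvPolynomial (Fin 4) K) + C t * X j =
      ∑ i, C (Function.update m j (m j + t) i) * X i := by
  have h : ∀ i : Fin 4, C (Function.update m j (m j + t) i) * X i =
      C (m i) * X i + (if i = j then C t * X j else 0) := by
    intro i
    by_cases hij : i = j
    · subst hij
      rw [Function.update_apply, if_pos rfl, if_pos rfl, map_add, add_mul]
    · rw [Function.update_apply, if_neg hij, if_neg hij, add_zero]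
  rw [Finset.sum_congr rfl fun i _ => h i, Finset.sum_add_distrib, Finset.sum_ite_eq' Finset.univ j,
    if_pos (Finset.mem_univ j)]

/-- **The one-step transport of a linear form is linear.**  If `m` satisfies the direction equation
`m_j + m·b = 0` of the step (`b_j = 0`), then `chartTransform 1 univ j (shear_{j,b} (Σ mᵢ xᵢ)) = Σ_{i ≠ j} mᵢ xᵢ`:
the strict transform of a hyperplane through the chart point is the hyperplane with the chart letter deleted — no
constant term, no `x_j`. [OURS] [cite: Hauser2010, §§F–G] -/
theorem chartTransform_one_shear_linearForm (j : Fin 4) {b : Fin 4 → K} (hbj : b j = 0) {m : Fin 4 → K}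
    (hdir : m j + dotProduct m b = 0) :
    chartTransform 1 Finset.univ j (shear j b (∑ i, C (m i) * X i : MvPolynomial (Fin 4) K)) =
      ∑ i, C (Function.update m j 0 i) * X i := by
  have hupd : Function.update m j (m j + dotProduct m b) = Function.update m j 0 := by rw [hdir]
  rw [shear_linearForm j hbj m, linearForm_add_C_mul_X, hupd, chartTransform_one_linear, Function.update_idem,
    Function.update_apply, if_pos rfl, C_0, zero_add]

/-- **Change of generator**: if `h = κ·L + κ′·x_a` with `κ ≠ 0` then `(x_a, h^d) = (x_a, L^d)`. [folklore] -/
theorem span_X_pow_eq_of_eq_linear {a : Fin 4} {h L : MvPolynomial (Fin 4) K} {κ κ' : K} (hκ : κ ≠ 0)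
    (hhL : h = C κ * L + C κ' * X a) (d : ℕ) :
    Ideal.span {(X a : MvPolynomial (Fin 4) K), h ^ d} = Ideal.span {(X a : MvPolynomial (Fin 4) K), L ^ d} := by
  have hsub : h ^ d - (C κ * L) ^ d ∈ Ideal.span {(X a : MvPolynomial (Fin 4) K)} := by
    rw [Ideal.mem_span_singleton]
    have h1 : h - C κ * L = X a * C κ' := by rw [hhL]; ring
    have h2 := sub_dvd_pow_sub_pow h (C κ * L) d
    rw [h1] at h2
    exact dvd_trans (dvd_mul_right _ _) h2
  have hXa : ∀ P : MvPolynomial (Fin 4) K,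
      (X a : MvPolynomial (Fin 4) K) ∈ Ideal.span {(X a : MvPolynomial (Fin 4) K), P} :=
    fun P => Ideal.subset_span (Set.mem_insert _ _)
  have hP : ∀ P : MvPolynomial (Fin 4) K, P ∈ Ideal.span {(X a : MvPolynomial (Fin 4) K), P} :=
    fun P => Ideal.subset_span (Set.mem_insert_of_mem _ (Set.mem_singleton _))
  have hmono : ∀ P : MvPolynomial (Fin 4) K,
      Ideal.span {(X a : MvPolynomial (Fin 4) K)} ≤ Ideal.span {(X a : MvPolynomial (Fin 4) K), P} :=
    fun P => Ideal.span_mono (Set.singleton_subset_iff.mpr (Set.mem_insert _ _))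
  apply le_antisymm
  · rw [Ideal.span_le]
    intro x hx
    simp only [Set.mem_insert_iff, Set.mem_singleton_iff] at hx
    rcases hx with rfl | rfl
    · exact hXa _
    · have heq : h ^ d = (h ^ d - (C κ * L) ^ d) + C (κ ^ d) * L ^ d := by rw [map_pow, mul_pow]; ring
      rw [SetLike.mem_coe, heq]
      exact Ideal.add_mem _ (hmono _ hsub) (Ideal.mul_mem_left _ _ (hP _))
  · rw [Ideal.span_le]
    intro x hx
    simp only [Set.mem_insert_iff, Set.mem_singleton_iff] at hx
    rcases hx with rfl | rfl
    · exact hXa _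
    · have heq : L ^ d = C (κ⁻¹ ^ d) * (h ^ d - (h ^ d - (C κ * L) ^ d)) := by
        rw [sub_sub_cancel, mul_pow, ← map_pow, ← mul_assoc, ← map_mul, ← mul_pow, inv_mul_cancel₀ hκ, one_pow,
          map_one, one_mul]
      rw [SetLike.mem_coe, heq]
      exact Ideal.mul_mem_left _ _ (Ideal.sub_mem _ (hP _) (hmono _ hsub))

/-- A linear form is its own degree-`1` component. [folklore] -/
theorem homogeneousComponent_one_linearForm (m : Fin 4 → K) :
    homogeneousComponent 1 (∑ i, C (m i) * X i : MvPolynomial (Fin 4) K) = ∑ i, C (m i) * X i := by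
  exact homogeneousComponent_eq_self (isHomogeneous_linearForm m)

/-- **A LINEAR ledger generator may be replaced by the vertex form** (K9 read exactly): if `u·G ∈ (x_a, (Σ mᵢ xᵢ)^d)`
with `u(0) ≠ 0`, `ord₀ G = d ≥ 1` and `in_d G = a₀·(Σ ℓᵢ xᵢ)^d` a power cone alive at a letter `i₀ ≠ a`, then
`u·G ∈ (x_a, (Σ ℓᵢ xᵢ)^d)` — for K9 gives `Σ mᵢ xᵢ = κ·(Σ ℓᵢ xᵢ) + κ′·x_a`, `κ ≠ 0`. [OURS]
[cite: ZariskiSamuel1960, Vol. II Ch. VII §1] -/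
theorem ledger_linearForm_of_linear {a : Fin 4} {u G : MvPolynomial (Fin 4) K} {d : ℕ} (hd : 1 ≤ d)
    {m : Fin 4 → K}
    (hG : u * G ∈ Ideal.span {(X a : MvPolynomial (Fin 4) K), (∑ i, C (m i) * X i) ^ d})
    (hu : MvPolynomial.eval 0 u ≠ 0) (hordG : ordZero G = d) {a₀ : K} {ℓ : Fin 4 → K}
    (hcone : homogeneousComponent d G = C a₀ * (∑ i, C (ℓ i) * X i) ^ d) (ha₀ : a₀ ≠ 0) {i₀ : Fin 4}
    (hi₀a : i₀ ≠ a) (hi₀ : ℓ i₀ ≠ 0) :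
    u * G ∈ Ideal.span {(X a : MvPolynomial (Fin 4) K), (∑ i, C (ℓ i) * X i) ^ d} := by
  have hg := homogeneousComponent_not_mem_span_X_of_powerCone hcone ha₀ hi₀a hi₀
  obtain ⟨κ, κ', hκ, hlin⟩ :=
    exists_homogeneousComponent_one_eq_of_ledger hd hG hu (linearForm_mem_originIdeal m) hordG hg hcone
  rw [homogeneousComponent_one_linearForm] at hlin
  rwa [span_X_pow_eq_of_eq_linear hκ hlin d] at hG

section Chain

variable (p : ℕ) [hp : Fact p.Prime] [DecidableEq K]

/-! ## §2 (K11a-lin) The one-letter ledger is generated by the current vertex form -/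

/-- **ONE KEPT STEP, linear form** (K4 + K9 on the chain): at a stage `k ≥ k₀` of a constant-shade tail with frame
data at `k` AND at `k + 1`, a letter `a` kept by the step (`j k ≠ a`, `b k a = 0`, `1 ≤ r_k(a)`), a letter
`i₀′ ≠ a` carrying `ℓ_{k+1}`, and an exact ledger `u·G_k ∈ (x_a, ℓ_k^d)` with `u(0) ≠ 0`: then
`(T₀u)(0) ≠ 0` and `T₀u·G_{k+1} ∈ (x_a, ℓ_{k+1}^d)`.  The transported generator `T₁ℓ_k = Σ_{i ≠ j_k} ℓ_k i·x_i`
is linear (`chartTransform_one_shear_linearForm`, direction equation `hdir`), so K9 trades it for `ℓ_{k+1}`. [OURS]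
[cite: CossartJannsenSaito2020, Thm. 3.10(4), Thm. 3.14] -/
theorem ledger_kept_step_linear {c : ℕ → State K} {j : ℕ → Fin 4} {b : ℕ → Fin 4 → K}
    (hc : ∀ k, IsIsolated p (c k).F ∧ Step0 p (c k) (c (k + 1))) (hw : FreeTail.IsWitnessedChain p c j b)
    (hr0 : ∀ e ∈ (c 0).F.support, (c 0).r ≤ e) (hfloor : ∀ k, ordZero (c k).F ≠ p) {k₀ d : ℕ} (hd : 1 ≤ d)
    (hshade : ∀ k, k₀ ≤ k → (c k).shade = (d : ℕ∞)) {k : ℕ} (hk : k₀ ≤ k) {ℓ ℓ' : Fin 4 → K} {a₀ a₀' : K}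
    (hform : resForm (c k) = C a₀ * (∑ i, C (ℓ i) * X i) ^ d)
    (hform' : resForm (c (k + 1)) = C a₀' * (∑ i, C (ℓ' i) * X i) ^ d)
    (hdir : ℓ (j k) + dotProduct ℓ (b k) = 0) {a : Fin 4} (hja : j k ≠ a) (hba : b k a = 0)
    (hra : 1 ≤ (c k).r a) {i₀ i₀' : Fin 4} (hi₀a : i₀ ≠ a) (hi₀ : ℓ i₀ ≠ 0) (hi₀a' : i₀' ≠ a)
    (hi₀' : ℓ' i₀' ≠ 0) {u : MvPolynomial (Fin 4) K} (hu : MvPolynomial.eval (0 : Fin 4 → K) u ≠ 0)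
    (hG : u * ((c k).F.divMonomial (c k).r) ∈
      Ideal.span {(X a : MvPolynomial (Fin 4) K), (∑ i, C (ℓ i) * X i) ^ d}) :
    MvPolynomial.eval (0 : Fin 4 → K) (chartTransform 0 Finset.univ (j k) (shear (j k) (b k) u)) ≠ 0 ∧
      chartTransform 0 Finset.univ (j k) (shear (j k) (b k) u) * ((c (k + 1)).F.divMonomial (c (k + 1)).r) ∈
        Ideal.span {(X a : MvPolynomial (Fin 4) K), (∑ i, C (ℓ' i) * X i) ^ d} := by
  classical
  obtain ⟨-, hu1, -, hG1⟩ := ledger_kept_step p hc hw hr0 hfloor hd hshade hk hform hdir hja hba hra hi₀a hi₀ hu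
    (linearForm_mem_originIdeal ℓ) hG
  refine ⟨hu1, ?_⟩
  rw [chartTransform_one_shear_linearForm (j k) (hw k).2.1 hdir] at hG1
  -- trade the transported linear generator for `ℓ'` at the state `k + 1`
  have hk1 : k₀ ≤ k + 1 := Nat.le_succ_of_le hk
  obtain ⟨o, ho, -, -, hod⟩ := chain_shade_nat p hc hfloor hshade hk1
  have hr := IsolatedBand.isolated_chain_forall_le hc hr0 (k + 1)
  have hcone : homogeneousComponent d ((c (k + 1)).F.divMonomial (c (k + 1)).r) =
      C a₀' * (∑ i, C (ℓ' i) * X i) ^ d := by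
    have h1 := hform'
    rw [resForm_eq_homogeneousComponent_divMonomial ho hr, hod] at h1
    exact h1
  have ha₀' : a₀' ≠ 0 := ne_zero_of_resForm_eq_C_mul ho hr hform'
  have hordG : ordZero ((c (k + 1)).F.divMonomial (c (k + 1)).r) = (d : ℕ∞) := by
    rw [ordZero_divMonomial_eq ho hr, hod]
  exact ledger_linearForm_of_linear hd hG1 hu1 hordG hcone ha₀' hi₀a' hi₀'

/-- **(K11a-lin) THE ONE-LETTER LEDGER IS GENERATED BY THE CURRENT VERTEX FORM, EXACTLY.**  Along a constant-shade
tail (`d ≥ 1`) of an isolated above-floor `Step0 p` chain with `x^{r₀} ∣ F₀` and frame data (`resForm = a_k·ℓ_k^d`,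
direction equation, propagation, carrying letter), for `k₀ ≤ k₁ < k` and `a = j_{k₁}` kept on `(k₁, k)`:
`∃ u, u(0) ≠ 0 ∧ u·G_k ∈ (x_a, (Σ_i ℓ_k i·x_i)^d)`.  Same binders as K11 `stretch_ledger_core`; induction on `k`
with base res-dim4-p-3 g3's K3 seed (born linear) and step `ledger_kept_step_linear`. [OURS]
[cite: CossartJannsenSaito2020, Thm. 3.10(4), Thm. 3.14] -/
theorem stretch_ledger_linear {c : ℕ → State K} {j : ℕ → Fin 4} {b : ℕ → Fin 4 → K}
    (hc : ∀ k, IsIsolated p (c k).F ∧ Step0 p (c k) (c (k + 1))) (hw : FreeTail.IsWitnessedChain p c j b)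
    (hr0 : ∀ e ∈ (c 0).F.support, (c 0).r ≤ e) (hfloor : ∀ k, ordZero (c k).F ≠ p) {k₀ d : ℕ} (hd : 1 ≤ d)
    (hshade : ∀ k, k₀ ≤ k → (c k).shade = (d : ℕ∞)) {ℓ : ℕ → Fin 4 → K} {a0 lam : ℕ → K}
    (hform : ∀ k, k₀ ≤ k → resForm (c k) = C (a0 k) * (∑ i, C (ℓ k i) * X i) ^ d)
    (hdir : ∀ k, k₀ ≤ k → ℓ k (j k) + dotProduct (ℓ k) (b k) = 0) (hlam : ∀ k, k₀ ≤ k → lam k ≠ 0)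
    (hprop : ∀ k, k₀ ≤ k → ∀ i, i ≠ j k → ℓ (k + 1) i = lam k * ℓ k i)
    (hcarry : ∀ k, k₀ ≤ k → ∃ i, i ≠ j k ∧ ℓ k i ≠ 0) {k₁ k : ℕ} (hk₁ : k₀ ≤ k₁) (hk : k₁ < k) {a : Fin 4}
    (ha : a = j k₁) (hkept : ∀ k'', k₁ < k'' → k'' < k → j k'' ≠ a ∧ b k'' a = 0) :
    ∃ u : MvPolynomial (Fin 4) K, MvPolynomial.eval (0 : Fin 4 → K) u ≠ 0 ∧
      u * ((c k).F.divMonomial (c k).r) ∈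
        Ideal.span {(X a : MvPolynomial (Fin 4) K), (∑ i, C (ℓ k i) * X i) ^ d} := by
  classical
  subst ha
  induction k, hk using Nat.le_induction with
  | base =>
    -- the seed is born linear: generator `Σ_{i ≠ j k₁} ℓ_{k₁} i x_i`, unit `1`
    obtain ⟨-, -, hG⟩ := stretch_seed_ledger p hc hw hr0 hfloor hshade hk₁ (hform k₁ hk₁) (hdir k₁ hk₁)
    obtain ⟨i₀, hi₀a, hi₀⟩ := contactSupport_not_subset_single hdir hlam hprop hcarry (fun k => (hw k).2.1) hk₁
      (Nat.lt_succ_self k₁) (fun k'' h1 h2 => absurd h2 (by omega))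
    have hk1 : k₀ ≤ k₁ + 1 := Nat.le_succ_of_le hk₁
    obtain ⟨o, ho, -, -, hod⟩ := chain_shade_nat p hc hfloor hshade hk1
    have hr := IsolatedBand.isolated_chain_forall_le hc hr0 (k₁ + 1)
    have hcone : homogeneousComponent d ((c (k₁ + 1)).F.divMonomial (c (k₁ + 1)).r) =
        C (a0 (k₁ + 1)) * (∑ i, C (ℓ (k₁ + 1) i) * X i) ^ d := by
      have h1 := hform (k₁ + 1) hk1
      rw [resForm_eq_homogeneousComponent_divMonomial ho hr, hod] at h1
      exact h1
    have ha₀ : a0 (k₁ + 1) ≠ 0 := ne_zero_of_resForm_eq_C_mul ho hr (hform (k₁ + 1) hk1)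
    have hordG : ordZero ((c (k₁ + 1)).F.divMonomial (c (k₁ + 1)).r) = (d : ℕ∞) := by
      rw [ordZero_divMonomial_eq ho hr, hod]
    refine ⟨1, by rw [map_one]; exact one_ne_zero, ?_⟩
    exact ledger_linearForm_of_linear hd hG (by rw [map_one]; exact one_ne_zero) hordG hcone ha₀ hi₀a hi₀
  | succ k hk ih =>
    obtain ⟨hja, hba⟩ := hkept k hk (Nat.lt_succ_self k)
    have hkept' : ∀ k'', k₁ < k'' → k'' < k → j k'' ≠ j k₁ ∧ b k'' (j k₁) = 0 :=
      fun k'' h1 h2 => hkept k'' h1 (Nat.lt_succ_of_lt h2)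
    obtain ⟨u, hu, hG⟩ := ih hkept'
    have hra : 1 ≤ (c k).r (j k₁) :=
      (stretch_ledger_core p hc hw hr0 hfloor hd hshade hform hdir hlam hprop hcarry hk₁ hk rfl hkept').1
    obtain ⟨i₀, hi₀a, hi₀⟩ :=
      contactSupport_not_subset_single hdir hlam hprop hcarry (fun k => (hw k).2.1) hk₁ hk hkept'
    obtain ⟨i₀', hi₀a', hi₀'⟩ :=
      contactSupport_not_subset_single hdir hlam hprop hcarry (fun k => (hw k).2.1) hk₁ (Nat.lt_succ_of_lt hk) hkept
    have hk0 : k₀ ≤ k := hk₁.trans (Nat.le_of_succ_le hk)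
    obtain ⟨hu1, hG1⟩ := ledger_kept_step_linear p hc hw hr0 hfloor hd hshade hk0 (hform k hk0)
      (hform (k + 1) (Nat.le_succ_of_le hk0)) (hdir k hk0) hja hba hra hi₀a hi₀ hi₀a' hi₀' hu hG
    exact ⟨_, hu1, hG1⟩

/-! ## §3 (K11-lin, pair form) Two stretch-born kept letters: the EXACT pair ledger -/

/-- **(K11-lin) THE EXACT PAIR LEDGER of two stretch-born kept letters.**  On a power-cone stretch (`d ≥ 1`) with
frame data, two distinct letters `a = j_{ta}`, `a′ = j_{ta′}` born in the stretch and kept on `(ta, k)`, `(ta′, k)`,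
and a third letter `e ∉ {a, a′}` carrying the vertex form (`ℓ_k e ≠ 0`; res-dim4-typ-1 g2's K13b
`contactSupport_not_subset_pair` supplies it):
`∃ U S T, U(0) ≠ 0 ∧ U·G_k = S·(x_a x_{a′}) + T·(Σ_i ℓ_k i·x_i)^d`.
The two linear ledgers of §2 have the SAME generator `ℓ_k ∉ (x_a, x_{a′})`, so res-dim4-p-12 g3's K2 merge
`mem_span_mul_of_mem_span_of_mem_span` (`K[x]` factorial) applies to `(u u′)·G_k`. [OURS]
[cite: CossartJannsenSaito2020, Thm. 3.10(4), Thm. 3.14] -/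
theorem stretch_pair_ledger_linear {c : ℕ → State K} {j : ℕ → Fin 4} {b : ℕ → Fin 4 → K}
    (hc : ∀ k, IsIsolated p (c k).F ∧ Step0 p (c k) (c (k + 1))) (hw : FreeTail.IsWitnessedChain p c j b)
    (hr0 : ∀ e ∈ (c 0).F.support, (c 0).r ≤ e) (hfloor : ∀ k, ordZero (c k).F ≠ p) {k₀ d : ℕ} (hd : 1 ≤ d)
    (hshade : ∀ k, k₀ ≤ k → (c k).shade = (d : ℕ∞)) {ℓ : ℕ → Fin 4 → K} {a0 lam : ℕ → K}
    (hform : ∀ k, k₀ ≤ k → resForm (c k) = C (a0 k) * (∑ i, C (ℓ k i) * X i) ^ d)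
    (hdir : ∀ k, k₀ ≤ k → ℓ k (j k) + dotProduct (ℓ k) (b k) = 0) (hlam : ∀ k, k₀ ≤ k → lam k ≠ 0)
    (hprop : ∀ k, k₀ ≤ k → ∀ i, i ≠ j k → ℓ (k + 1) i = lam k * ℓ k i)
    (hcarry : ∀ k, k₀ ≤ k → ∃ i, i ≠ j k ∧ ℓ k i ≠ 0) {k : ℕ} {a a' e : Fin 4} (haa : a ≠ a')
    (hea : e ≠ a) (hea' : e ≠ a') (hℓe : ℓ k e ≠ 0)
    {ta ta' : ℕ} (hta : k₀ ≤ ta) (htak : ta < k) (hja : j ta = a)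
    (hkepta : ∀ m, ta < m → m < k → j m ≠ a ∧ b m a = 0) (hta' : k₀ ≤ ta') (hta'k : ta' < k)
    (hja' : j ta' = a') (hkepta' : ∀ m, ta' < m → m < k → j m ≠ a' ∧ b m a' = 0) :
    ∃ U S T : MvPolynomial (Fin 4) K, MvPolynomial.eval (0 : Fin 4 → K) U ≠ 0 ∧
      U * ((c k).F.divMonomial (c k).r) =
        S * (X a * X a') + T * (∑ i, C (ℓ k i) * X i) ^ d := by
  classical
  obtain ⟨u, hu, hGa⟩ := stretch_ledger_linear p hc hw hr0 hfloor hd hshade hform hdir hlam hprop hcarry hta htak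
    hja.symm hkepta
  obtain ⟨u', hu', hGb⟩ := stretch_ledger_linear p hc hw hr0 hfloor hd hshade hform hdir hlam hprop hcarry hta'
    hta'k hja'.symm hkepta'
  -- the common generator `ℓ_k` does not lie in `(x_a, x_{a′})`: it charges `e`
  have hℓ : (∑ i, C (ℓ k i) * X i : MvPolynomial (Fin 4) K) ∉ Ideal.span {(X a : MvPolynomial (Fin 4) K), X a'} := by
    intro hmem
    obtain ⟨s, t, hst⟩ := Ideal.mem_span_pair.mp hmem
    have hcoeff := congrArg (coeff (Finsupp.single e 1)) hst
    simp only [coeff_add, coeff_mul_X', Finsupp.mem_support_iff, Finsupp.single_apply, hea, hea', ne_eq,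
      if_false, not_true_eq_false, add_zero, coeff_single_linearForm] at hcoeff
    exact hℓe hcoeff.symm
  -- merge the two one-letter ledgers of `(u u′)·G_k`
  have hGa' : u' * u * ((c k).F.divMonomial (c k).r) ∈
      Ideal.span {(X a : MvPolynomial (Fin 4) K), (∑ i, C (ℓ k i) * X i) ^ d} := by
    rw [mul_assoc]; exact Ideal.mul_mem_left _ _ hGa
  have hGb' : u' * u * ((c k).F.divMonomial (c k).r) ∈
      Ideal.span {(X a' : MvPolynomial (Fin 4) K), (∑ i, C (ℓ k i) * X i) ^ d} := by
    rw [mul_comm u' u, mul_assoc]; exact Ideal.mul_mem_left _ _ hGb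
  have hmerge := IsolatedBand.mem_span_mul_of_mem_span_of_mem_span haa hℓ hGa' hGb'
  obtain ⟨S, T, hST⟩ := Ideal.mem_span_pair.mp hmerge
  refine ⟨u' * u, S, T, ?_, hST.symm⟩
  rw [map_mul]
  exact mul_ne_zero hu' hu

end Chain

end ResCone

end Summit.ResolutionOfSingularities.ResolutionOfSingularities.Theorems.PIDim4

end
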